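import Summits.QuantumFields.YangMills.Theorems.UnitScaleTiltFluctuationComparisonRegPrLiftSecondOrder
import Literature.MathematicalPhysics.QuantumFieldTheory.Balaban1983to89.T4TiltOscillation
import HarnessLib

/-!
# Line «covariant_discharge» on crux `HistoryTailL` (stmt-QuantumFields-19936) — (E-4) SWEEP ACTION-VARIATION LETTERS:
# the pointwise second-order expansion of the Wilson action under a left sweep `W ↦ E·W`

Cell `ym3-torus` (YM ladder rung R3 = continuum SU(2) Yang–Mills on the three-torus — a RUNG, NOT the Clay problem: not d = 4,
not infinite volume, not a mass gap), twin-width seat `ym-ust-19936-w8` gen 4, helper for the crux `HistoryTailL`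
(stmt-QuantumFields-19936), `--supports` only.  The line «covariant_discharge» (`Cruxes/HistoryTailL/Lines/covariant_discharge.lean`)
has been REDUCED by the kernel (✓ `CovariantDischargeSweepGapReduction.unboundedDepth_of_sweepGap`, seat w3 g8) to ONE deterministic
inequality family (HGap): on the window event, undoing a Haar-preserving sweep `Ψ` LOWERS the Wilson action,
`c_g·p(g_{K−j})² − D ≤ β_K·(A(V) − A(Ψ′V))`.  Pointwise, every sweep of single-link left translations is a bondwise left product
`Ψ′V = E·V` (`ApproxLift.mulField E V`, `E b ∈ G`).  THIS FILE is the pointwise bookkeeping of `A(W) − A(E·W)` that any discharge of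
(HGap) starts from — for a GENERIC gauge group under the tree's trace shapes, and in the matrix model `SU(n)`:

* §1 (any `GaugeGroup G`) `wilsonAction_mulField_sub_eq_sum` / `wilsonAction4_sub_mulField_eq_sum`: by the exact identity
  `(E·W)(∂p) = H_p · W(∂p)` (✓ `ApproxLift.plaqHol_mul_left`, `H_p = twistedCobd E W p` the twisted coboundary of `E` around `p`)
  the action change is the plaquette sum `A(W) − A(E·W) = Σ_p [reTr (H_p W_p) − reTr W_p]`, and the algebraic SECOND-ORDER SPLIT
  `reTr (H W) − reTr W = PAIRING − (1 − reTr H)`, `PAIRING := reTr (H W) − reTr H − reTr W + 1` (`reTr_mul_sub_reTr_eq`):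
  `A(W) − A(E·W) = Σ_p PAIRING_p − Σ_p (1 − reTr H_p)` (`wilsonAction4_sub_mulField_eq_split`).  Plaquettes off the support of `E`
  drop out (`twistedCobd_eq_one`).  The QUADRATIC COST `Σ_p (1 − reTr H_p)` is `≥ 0` and, under the shape
  `∀ h, 1 − reTr h ≤ c_G·dist1 h²`, is `≤ c_G·Σ_p (4t_p)²` when the four sweep factors on `∂p` are within `t_p` of `1`
  (✓ `ApproxLift.dist1_twistedCobd_le`); under `T4TiltOscillation.ReTrQuad G` the pairing obeys `|PAIRING_p| ≤ 4t_p·dist1 W_p`,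
  whence the FIRST-ORDER WINDOW BUDGET `|A(W) − A(E·W) + Σ_p (1 − reTr H_p)| ≤ Σ_p 4t_p·dist1 W_p`.
* §2 (`G = SU(n)`, the cell's instance `UnitaryModel.instGaugeGroupSpecialUnitaryGroup`): the pairing IS the bilinear form
  `PAIRING_p = Re tr((H_p − 1)(W_p − 1))/n` (`pairing_eq_nReTr`), and by the second-order cancellation inside `H_p`
  (✓ `ApproxLift.norm_twistedCobd_sub_one_sub_lin_le`: `‖H_p − 1 − linCobd_p‖ ≤ 6t_p² + 4t_p³ + t_p⁴`) it is the LINEAR STATISTIC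
  `Λ_p := Re tr(linCobd_p·(W_p − 1))/n` — linear in `E − 1` AND in `W − 1` — up to `(6t_p² + 4t_p³ + t_p⁴)·dist1 W_p`
  (`abs_pairing_sub_lin_le`); `1 − reTr H_p ≤ 8t_p²` (✓ `MatrixNorms.two_mul_one_sub_nReTr_le_opDist1_sq`).  MAIN LETTER
  ★ `lin_sub_le_wilsonAction4_sub_mulField` / `wilsonAction4_sub_mulField_le`:
  `Σ_p Λ_p − Σ_p (6t_p²+4t_p³+t_p⁴)·dist1 W_p − 8·Σ_p t_p² ≤ A(W) − A(E·W) ≤ Σ_p Λ_p + Σ_p (6t_p²+4t_p³+t_p⁴)·dist1 W_p`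
  — the card's «`β_K(S(ΨU)−S(U)) = (θ/σ²)·Y_n̂(U) + ½β_K Σ(da)² + DEFECT`» with every term named, and exactly the shape of the `hgap`
  premise of ✓ `CovariantDischargeHaarSweepReweighting.measureReal_gibbsMeasure_le_exp_neg_mul` /
  ✓ `CovariantDischargeSweepGapReduction.gibbsK_real_le_exp_neg_of_gap` after multiplication by `β`.

WHAT THIS IS NOT.  Pointwise algebra only: nothing here chooses the sweep `E` (the frames / covariant directions that make
`linCobd_p ≈ (dα)_p·X`), bounds the statistic `Σ_p Λ_p` from below on the window event, or controls the variance constant — that is the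
XL content of (HGap); nothing of `stub_unboundedDepth`, `DeepWindowTailL`, `FractionalWindowTailL`, the crux `HistoryTailL`, the rung R3,
d = 4, a continuum limit or a mass gap is proved.  YM₃ on T³ is rung R3 of the programme, NOT the Clay problem.

References: T. Bałaban, CMP **98** (1985) 17–51 [Balaban1985Averaging] ((19)–(20) p.21: operator norm and `|Re tr X| ≤ |X|`);
CMP **109** (1987) 249–301 [Balaban1987RG1] ((0.2) p.252 the Wilson action, (0.14) `1 − Re tr V ≤ ½|V − 1|²`).  Everything in this
file is elementary algebra over those definitions ([folklore]).
-/

noncomputable section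

open scoped BigOperators Matrix.Norms.L2Operator

namespace Summit.QuantumFields.YangMills.Theorems.CovariantDischargeSweepActionVariation

open Literature.MathematicalPhysics.QuantumFieldTheory.Balaban1983to89
open Literature.MathematicalPhysics.QuantumFieldTheory.Balaban1983to89.UnitaryModel (nReTr nReTr_one opDist1)
open Literature.MathematicalPhysics.QuantumFieldTheory.Balaban1983to89.MatrixNorms
  (abs_nReTr_le_opNorm two_mul_one_sub_nReTr_le_opDist1_sq)
open Literature.MathematicalPhysics.QuantumFieldTheory.Balaban1983to89.T4TiltOscillation
  (ReTrQuad reTrQuad_specialUnitaryGroup nReTr_add nReTr_sub)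
open Summit.QuantumFields.YangMills.Theorems.ApproxLift
  (mulField mulField_apply twistedCobd plaqHol_mul_left dist1_twistedCobd_le linCobd norm_twistedCobd_sub_one_sub_lin_le)

/-! ## §1 Any gauge group: the plaquette sum, the second-order split, locality, first-order budget -/

section Generic

variable {P : Params} {j : ℕ} {G : Type*} [GaugeGroup G]

/-- THE SECOND-ORDER SPLIT (pure algebra): `reTr (H W) − reTr W = PAIRING − (1 − reTr H)` with
`PAIRING = reTr (H W) − reTr H − reTr W + 1` (in a unitary model `Re tr((H − 1)(W − 1))/n`). [folklore] -/
theorem reTr_mul_sub_reTr_eq (H W : G) :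
    reTr (H * W) - reTr W = (reTr (H * W) - reTr H - reTr W + 1) - (1 - reTr H) := by
  ring

/-- **THE ACTION CHANGE OF A LEFT SWEEP IS A PLAQUETTE SUM OVER TWISTED COBOUNDARIES** (weight `w`):
`A_w(W) − A_w(E·W) = Σ_p w·(reTr (H_p · W(∂p)) − reTr W(∂p))`, `H_p = twistedCobd E W p`. [cite: Balaban1987RG1, (0.2) p.252] -/
theorem wilsonAction_sub_mulField_eq_sum (w : ℝ) (E W : GaugeField P j G) :
    wilsonAction w W - wilsonAction w (mulField E W) =
      ∑ p : Plaq P j, w * (reTr (twistedCobd E W p * GaugeField.plaqHol W p) - reTr (GaugeField.plaqHol W p)) := by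
  unfold wilsonAction
  rw [← Finset.sum_sub_distrib]
  refine Finset.sum_congr rfl fun p _ => ?_
  rw [plaqHol_mul_left]
  ring

/-- The same for the unit-weight action `wilsonAction4`:
`A(W) − A(E·W) = Σ_p (reTr (H_p · W(∂p)) − reTr W(∂p))`. [cite: Balaban1987RG1, (0.2) p.252] -/
theorem wilsonAction4_sub_mulField_eq_sum (E W : GaugeField P j G) :
    wilsonAction4 W - wilsonAction4 (mulField E W) =
      ∑ p : Plaq P j, (reTr (twistedCobd E W p * GaugeField.plaqHol W p) - reTr (GaugeField.plaqHol W p)) := by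
  unfold wilsonAction4
  rw [wilsonAction_sub_mulField_eq_sum]
  exact Finset.sum_congr rfl fun p _ => one_mul _

/-- **SECOND-ORDER SPLIT OF THE WHOLE ACTION CHANGE**: `A(W) − A(E·W) = Σ_p PAIRING_p − Σ_p (1 − reTr H_p)`.
[cite: Balaban1987RG1, (0.2) p.252] -/
theorem wilsonAction4_sub_mulField_eq_split (E W : GaugeField P j G) :
    wilsonAction4 W - wilsonAction4 (mulField E W) =
      (∑ p : Plaq P j, (reTr (twistedCobd E W p * GaugeField.plaqHol W p) - reTr (twistedCobd E W p) -
          reTr (GaugeField.plaqHol W p) + 1)) -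
        ∑ p : Plaq P j, (1 - reTr (twistedCobd E W p)) := by
  rw [wilsonAction4_sub_mulField_eq_sum, ← Finset.sum_sub_distrib]
  exact Finset.sum_congr rfl fun p _ => reTr_mul_sub_reTr_eq _ _

/-- LOCALITY: if the sweep is trivial on the four bonds of `∂p` then `H_p = 1` (the plaquette drops out of every sum below). [folklore] -/
theorem twistedCobd_eq_one {E : GaugeField P j G} (W : GaugeField P j G) (p : Plaq P j) (h₁ : E ⟨p.src, p.μ⟩ = 1)
    (h₂ : E ⟨p.src.shift p.μ, p.ν⟩ = 1) (h₃ : E ⟨p.src.shift p.ν, p.μ⟩ = 1) (h₄ : E ⟨p.src, p.ν⟩ = 1) :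
    twistedCobd E W p = 1 := by
  simp only [twistedCobd, h₁, h₂, h₃, h₄, inv_one, mul_one, mul_inv_cancel]

/-- … hence such a plaquette contributes `0` to the action change. [folklore] -/
theorem reTr_twistedCobd_mul_sub_eq_zero {E : GaugeField P j G} (W : GaugeField P j G) (p : Plaq P j) (h₁ : E ⟨p.src, p.μ⟩ = 1)
    (h₂ : E ⟨p.src.shift p.μ, p.ν⟩ = 1) (h₃ : E ⟨p.src.shift p.ν, p.μ⟩ = 1) (h₄ : E ⟨p.src, p.ν⟩ = 1) :
    reTr (twistedCobd E W p * GaugeField.plaqHol W p) - reTr (GaugeField.plaqHol W p) = 0 := by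
  rw [twistedCobd_eq_one W p h₁ h₂ h₃ h₄, one_mul, sub_self]

/-- The twisted coboundary is within `4t_p` of `1` when the four sweep factors on `∂p` are within `t_p` of `1`. [folklore] -/
theorem dist1_twistedCobd_le_four_mul {E : GaugeField P j G} (W : GaugeField P j G) (p : Plaq P j) {t : ℝ}
    (h₁ : dist1 (E ⟨p.src, p.μ⟩) ≤ t) (h₂ : dist1 (E ⟨p.src.shift p.μ, p.ν⟩) ≤ t) (h₃ : dist1 (E ⟨p.src.shift p.ν, p.μ⟩) ≤ t)
    (h₄ : dist1 (E ⟨p.src, p.ν⟩) ≤ t) : dist1 (twistedCobd E W p) ≤ 4 * t := by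
  have h := dist1_twistedCobd_le E W p
  linarith

/-- QUADRATIC COST, one plaquette, under the second-order trace shape `1 − reTr h ≤ c_G·dist1 h²` (`c_G = ½` in `U(n)`, `SU(n)`):
`1 − reTr H_p ≤ c_G·(4t_p)²`. [cite: Balaban1987RG1, (0.14) p.254] -/
theorem one_sub_reTr_twistedCobd_le {cG : ℝ} (hG : ∀ h : G, 1 - reTr h ≤ cG * dist1 h ^ 2) (hcG : 0 ≤ cG)
    {E : GaugeField P j G} (W : GaugeField P j G) (p : Plaq P j) {t : ℝ}
    (h₁ : dist1 (E ⟨p.src, p.μ⟩) ≤ t) (h₂ : dist1 (E ⟨p.src.shift p.μ, p.ν⟩) ≤ t) (h₃ : dist1 (E ⟨p.src.shift p.ν, p.μ⟩) ≤ t)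
    (h₄ : dist1 (E ⟨p.src, p.ν⟩) ≤ t) : 1 - reTr (twistedCobd E W p) ≤ cG * (4 * t) ^ 2 := by
  have hd := dist1_twistedCobd_le_four_mul W p h₁ h₂ h₃ h₄
  calc 1 - reTr (twistedCobd E W p) ≤ cG * dist1 (twistedCobd E W p) ^ 2 := hG _
    _ ≤ cG * (4 * t) ^ 2 :=
        mul_le_mul_of_nonneg_left (pow_le_pow_left₀ (GaugeGroup.dist1_nonneg _) hd 2) hcG

/-- QUADRATIC COST, summed: `0 ≤ Σ_p (1 − reTr H_p)`. [folklore] -/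
theorem sum_one_sub_reTr_twistedCobd_nonneg (E W : GaugeField P j G) :
    0 ≤ ∑ p : Plaq P j, (1 - reTr (twistedCobd E W p)) :=
  Finset.sum_nonneg fun p _ => sub_nonneg.mpr (GaugeGroup.reTr_le_one (twistedCobd E W p))

/-- QUADRATIC COST, summed, under the shape: `Σ_p (1 − reTr H_p) ≤ c_G·Σ_p (4t_p)²` for plaquette-wise factor bounds `t_p`.
[cite: Balaban1987RG1, (0.14) p.254] -/
theorem sum_one_sub_reTr_twistedCobd_le {cG : ℝ} (hG : ∀ h : G, 1 - reTr h ≤ cG * dist1 h ^ 2) (hcG : 0 ≤ cG)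
    {E : GaugeField P j G} (W : GaugeField P j G) {t : Plaq P j → ℝ}
    (h₁ : ∀ p : Plaq P j, dist1 (E ⟨p.src, p.μ⟩) ≤ t p) (h₂ : ∀ p : Plaq P j, dist1 (E ⟨p.src.shift p.μ, p.ν⟩) ≤ t p)
    (h₃ : ∀ p : Plaq P j, dist1 (E ⟨p.src.shift p.ν, p.μ⟩) ≤ t p) (h₄ : ∀ p : Plaq P j, dist1 (E ⟨p.src, p.ν⟩) ≤ t p) :
    ∑ p : Plaq P j, (1 - reTr (twistedCobd E W p)) ≤ cG * ∑ p : Plaq P j, (4 * t p) ^ 2 := by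
  rw [Finset.mul_sum]
  exact Finset.sum_le_sum fun p _ => one_sub_reTr_twistedCobd_le hG hcG W p (h₁ p) (h₂ p) (h₃ p) (h₄ p)

/-- PAIRING, one plaquette, under `ReTrQuad G`: `|PAIRING_p| ≤ 4t_p·dist1 W(∂p)`. [cite: Balaban1985Averaging, (20) p.21] -/
theorem abs_pairing_twistedCobd_le (hQ : ReTrQuad G) {E : GaugeField P j G} (W : GaugeField P j G) (p : Plaq P j) {t : ℝ}
    (h₁ : dist1 (E ⟨p.src, p.μ⟩) ≤ t) (h₂ : dist1 (E ⟨p.src.shift p.μ, p.ν⟩) ≤ t) (h₃ : dist1 (E ⟨p.src.shift p.ν, p.μ⟩) ≤ t)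
    (h₄ : dist1 (E ⟨p.src, p.ν⟩) ≤ t) :
    |reTr (twistedCobd E W p * GaugeField.plaqHol W p) - reTr (twistedCobd E W p) - reTr (GaugeField.plaqHol W p) + 1| ≤
      4 * t * dist1 (GaugeField.plaqHol W p) :=
  (hQ _ _).trans (mul_le_mul_of_nonneg_right (dist1_twistedCobd_le_four_mul W p h₁ h₂ h₃ h₄) (GaugeGroup.dist1_nonneg _))

/-- **FIRST-ORDER WINDOW BUDGET** (any `GaugeGroup` with `ReTrQuad`): the action change plus the quadratic cost is bounded by the
first-order pairing budget, `|A(W) − A(E·W) + Σ_p (1 − reTr H_p)| ≤ Σ_p 4t_p·dist1 W(∂p)`. [cite: Balaban1985Averaging, (20) p.21] -/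
theorem abs_wilsonAction4_sub_mulField_add_quad_le (hQ : ReTrQuad G) {E : GaugeField P j G} (W : GaugeField P j G)
    {t : Plaq P j → ℝ}
    (h₁ : ∀ p : Plaq P j, dist1 (E ⟨p.src, p.μ⟩) ≤ t p) (h₂ : ∀ p : Plaq P j, dist1 (E ⟨p.src.shift p.μ, p.ν⟩) ≤ t p)
    (h₃ : ∀ p : Plaq P j, dist1 (E ⟨p.src.shift p.ν, p.μ⟩) ≤ t p) (h₄ : ∀ p : Plaq P j, dist1 (E ⟨p.src, p.ν⟩) ≤ t p) :
    |wilsonAction4 W - wilsonAction4 (mulField E W) + ∑ p : Plaq P j, (1 - reTr (twistedCobd E W p))| ≤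
      ∑ p : Plaq P j, 4 * t p * dist1 (GaugeField.plaqHol W p) := by
  rw [wilsonAction4_sub_mulField_eq_split, sub_add_cancel]
  exact (Finset.abs_sum_le_sum_abs _ _).trans
    (Finset.sum_le_sum fun p _ => abs_pairing_twistedCobd_le hQ W p (h₁ p) (h₂ p) (h₃ p) (h₄ p))

/-- The same with a uniform plaquette bound `dist1 W(∂p) ≤ δ` (a `PlaqSmall`-type window) and `t_p ≥ 0`:
`|A(W) − A(E·W) + Σ_p (1 − reTr H_p)| ≤ δ·Σ_p 4t_p`. [cite: Balaban1985Averaging, (20) p.21] -/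
theorem abs_wilsonAction4_sub_mulField_add_quad_le_of_plaq (hQ : ReTrQuad G) {E : GaugeField P j G} (W : GaugeField P j G)
    {t : Plaq P j → ℝ} (ht : ∀ p, 0 ≤ t p)
    (h₁ : ∀ p : Plaq P j, dist1 (E ⟨p.src, p.μ⟩) ≤ t p) (h₂ : ∀ p : Plaq P j, dist1 (E ⟨p.src.shift p.μ, p.ν⟩) ≤ t p)
    (h₃ : ∀ p : Plaq P j, dist1 (E ⟨p.src.shift p.ν, p.μ⟩) ≤ t p) (h₄ : ∀ p : Plaq P j, dist1 (E ⟨p.src, p.ν⟩) ≤ t p)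
    {δ : ℝ} (hW : ∀ p : Plaq P j, dist1 (GaugeField.plaqHol W p) ≤ δ) :
    |wilsonAction4 W - wilsonAction4 (mulField E W) + ∑ p : Plaq P j, (1 - reTr (twistedCobd E W p))| ≤
      δ * ∑ p : Plaq P j, 4 * t p := by
  refine (abs_wilsonAction4_sub_mulField_add_quad_le hQ W h₁ h₂ h₃ h₄).trans ?_
  rw [Finset.mul_sum]
  refine Finset.sum_le_sum fun p _ => ?_
  calc 4 * t p * dist1 (GaugeField.plaqHol W p) ≤ 4 * t p * δ :=
        mul_le_mul_of_nonneg_left (hW p) (by linarith [ht p])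
    _ = δ * (4 * t p) := by ring

/-- Two-sided form of the first-order budget under both shapes:
`−Σ_p 4t_p·dist1 W(∂p) − c_G·Σ_p (4t_p)² ≤ A(W) − A(E·W) ≤ Σ_p 4t_p·dist1 W(∂p)`. [cite: Balaban1987RG1, (0.14) p.254] -/
theorem wilsonAction4_sub_mulField_mem_Icc (hQ : ReTrQuad G) {cG : ℝ} (hG : ∀ h : G, 1 - reTr h ≤ cG * dist1 h ^ 2)
    (hcG : 0 ≤ cG) {E : GaugeField P j G} (W : GaugeField P j G) {t : Plaq P j → ℝ}
    (h₁ : ∀ p : Plaq P j, dist1 (E ⟨p.src, p.μ⟩) ≤ t p) (h₂ : ∀ p : Plaq P j, dist1 (E ⟨p.src.shift p.μ, p.ν⟩) ≤ t p)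
    (h₃ : ∀ p : Plaq P j, dist1 (E ⟨p.src.shift p.ν, p.μ⟩) ≤ t p) (h₄ : ∀ p : Plaq P j, dist1 (E ⟨p.src, p.ν⟩) ≤ t p) :
    -(∑ p : Plaq P j, 4 * t p * dist1 (GaugeField.plaqHol W p)) - cG * ∑ p : Plaq P j, (4 * t p) ^ 2 ≤
        wilsonAction4 W - wilsonAction4 (mulField E W) ∧
      wilsonAction4 W - wilsonAction4 (mulField E W) ≤ ∑ p : Plaq P j, 4 * t p * dist1 (GaugeField.plaqHol W p) := by
  have h := abs_le.mp (abs_wilsonAction4_sub_mulField_add_quad_le hQ W h₁ h₂ h₃ h₄)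
  have hq0 := sum_one_sub_reTr_twistedCobd_nonneg E W
  have hq1 := sum_one_sub_reTr_twistedCobd_le hG hcG W h₁ h₂ h₃ h₄
  constructor <;> linarith [h.1, h.2]

end Generic

/-! ## §2 The matrix model `SU(n)`: the pairing is `Re tr((H − 1)(W − 1))/n`, and the linear statistic -/

section SU

variable {P : Params} {j : ℕ} {n : Type*} [Fintype n] [DecidableEq n] [Nonempty n]

/-- In the cell's `SU(n)` instance `reTr` is the normalised real trace of the matrix (definitional). [cite: Balaban1987RG1, (0.2) p.252] -/
theorem reTr_eq_nReTr (g : Matrix.specialUnitaryGroup n ℂ) : reTr g = nReTr (g : Matrix n n ℂ) := rfl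

/-- **THE PAIRING IS THE BILINEAR FORM `Re tr((H − 1)(W − 1))/n`.** [cite: Balaban1985Averaging, (20) p.21] -/
theorem pairing_eq_nReTr (H W : Matrix.specialUnitaryGroup n ℂ) :
    reTr (H * W) - reTr H - reTr W + 1 = nReTr ((((H : Matrix n n ℂ)) - 1) * (((W : Matrix n n ℂ)) - 1)) := by
  have e : (((H : Matrix n n ℂ)) - 1) * (((W : Matrix n n ℂ)) - 1) =
      (H : Matrix n n ℂ) * (W : Matrix n n ℂ) - (H : Matrix n n ℂ) - (W : Matrix n n ℂ) + 1 := by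
    noncomm_ring
  rw [e, nReTr_add, nReTr_sub, nReTr_sub, nReTr_one, reTr_eq_nReTr, reTr_eq_nReTr, reTr_eq_nReTr, Submonoid.coe_mul]

/-- `1 − reTr g ≤ ½·dist1 g²` in `SU(n)` ([Balaban1987RG1] (0.14), operator-norm half; the tree's
`MatrixNorms.two_mul_one_sub_nReTr_le_opDist1_sq`). [cite: Balaban1987RG1, (0.14) p.254] -/
theorem one_sub_reTr_le_half_dist1_sq (g : Matrix.specialUnitaryGroup n ℂ) : 1 - reTr g ≤ 1 / 2 * dist1 g ^ 2 := by
  have h := two_mul_one_sub_nReTr_le_opDist1_sq (n := n) (Matrix.specialUnitaryGroup_le_unitaryGroup g.2)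
  have hd : dist1 g = opDist1 (g : Matrix n n ℂ) := rfl
  rw [reTr_eq_nReTr, hd]
  linarith

/-- `|Re tr(X·(W − 1))/n| ≤ ‖X‖·dist1 W` — the pairing of any matrix against a plaquette deviation. [cite: Balaban1985Averaging, (20) p.21] -/
theorem abs_nReTr_mul_sub_one_le (X : Matrix n n ℂ) (W : Matrix.specialUnitaryGroup n ℂ) :
    |nReTr (X * ((W : Matrix n n ℂ) - 1))| ≤ ‖X‖ * dist1 W := by
  show |nReTr (X * ((W : Matrix n n ℂ) - 1))| ≤ ‖X‖ * ‖(W : Matrix n n ℂ) - 1‖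
  exact (abs_nReTr_le_opNorm _).trans (Matrix.l2_opNorm_mul _ _)

/-- **THE PAIRING IS THE LINEAR STATISTIC TO SECOND ORDER**: with `Λ_p = Re tr(linCobd_p·(W(∂p) − 1))/n`,
`|PAIRING_p − Λ_p| ≤ (6t_p² + 4t_p³ + t_p⁴)·dist1 W(∂p)` when the four sweep factors on `∂p` are within `t_p` of `1`.
[cite: Balaban1985Averaging, (20) p.21] -/
theorem abs_pairing_sub_lin_le (E W : GaugeField P j (Matrix.specialUnitaryGroup n ℂ)) (p : Plaq P j) {t : ℝ}
    (h₁ : dist1 (E ⟨p.src, p.μ⟩) ≤ t) (h₂ : dist1 (E ⟨p.src.shift p.μ, p.ν⟩) ≤ t) (h₃ : dist1 (E ⟨p.src.shift p.ν, p.μ⟩) ≤ t)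
    (h₄ : dist1 (E ⟨p.src, p.ν⟩) ≤ t) :
    |(reTr (twistedCobd E W p * GaugeField.plaqHol W p) - reTr (twistedCobd E W p) - reTr (GaugeField.plaqHol W p) + 1) -
        nReTr (linCobd E W p * (((GaugeField.plaqHol W p : Matrix.specialUnitaryGroup n ℂ) : Matrix n n ℂ) - 1))| ≤
      (6 * t ^ 2 + 4 * t ^ 3 + t ^ 4) * dist1 (GaugeField.plaqHol W p) := by
  rw [pairing_eq_nReTr, ← nReTr_sub, ← sub_mul]
  refine (abs_nReTr_mul_sub_one_le _ _).trans ?_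
  exact mul_le_mul_of_nonneg_right (norm_twistedCobd_sub_one_sub_lin_le E W p h₁ h₂ h₃ h₄) (GaugeGroup.dist1_nonneg _)

/-- Crude size of the linear statistic at one plaquette: `|Λ_p| ≤ (4t_p + 6t_p² + 4t_p³ + t_p⁴)·dist1 W(∂p)`.
[cite: Balaban1985Averaging, (20) p.21] -/
theorem abs_lin_le (E W : GaugeField P j (Matrix.specialUnitaryGroup n ℂ)) (p : Plaq P j) {t : ℝ}
    (h₁ : dist1 (E ⟨p.src, p.μ⟩) ≤ t) (h₂ : dist1 (E ⟨p.src.shift p.μ, p.ν⟩) ≤ t) (h₃ : dist1 (E ⟨p.src.shift p.ν, p.μ⟩) ≤ t)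
    (h₄ : dist1 (E ⟨p.src, p.ν⟩) ≤ t) :
    |nReTr (linCobd E W p * (((GaugeField.plaqHol W p : Matrix.specialUnitaryGroup n ℂ) : Matrix n n ℂ) - 1))| ≤
      (4 * t + (6 * t ^ 2 + 4 * t ^ 3 + t ^ 4)) * dist1 (GaugeField.plaqHol W p) := by
  have hpair := abs_pairing_twistedCobd_le (reTrQuad_specialUnitaryGroup (n := n)) W p h₁ h₂ h₃ h₄
  have hlin := abs_pairing_sub_lin_le E W p h₁ h₂ h₃ h₄
  rw [abs_sub_comm] at hlin
  have := abs_sub_le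
    (nReTr (linCobd E W p * (((GaugeField.plaqHol W p : Matrix.specialUnitaryGroup n ℂ) : Matrix n n ℂ) - 1)))
    (reTr (twistedCobd E W p * GaugeField.plaqHol W p) - reTr (twistedCobd E W p) - reTr (GaugeField.plaqHol W p) + 1) 0
  rw [sub_zero, sub_zero] at this
  linarith

/-- **SECOND-ORDER EXPANSION OF THE SWEEP ACTION CHANGE in `SU(n)`**: with the linear statistic `Λ = Σ_p Λ_p` and the quadratic
cost `Q = Σ_p (1 − reTr H_p)`, `|A(W) − A(E·W) + Q − Λ| ≤ Σ_p (6t_p² + 4t_p³ + t_p⁴)·dist1 W(∂p)`.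
[cite: Balaban1987RG1, (0.2) p.252] -/
theorem abs_wilsonAction4_sub_mulField_add_quad_sub_lin_le (E W : GaugeField P j (Matrix.specialUnitaryGroup n ℂ))
    {t : Plaq P j → ℝ}
    (h₁ : ∀ p : Plaq P j, dist1 (E ⟨p.src, p.μ⟩) ≤ t p) (h₂ : ∀ p : Plaq P j, dist1 (E ⟨p.src.shift p.μ, p.ν⟩) ≤ t p)
    (h₃ : ∀ p : Plaq P j, dist1 (E ⟨p.src.shift p.ν, p.μ⟩) ≤ t p) (h₄ : ∀ p : Plaq P j, dist1 (E ⟨p.src, p.ν⟩) ≤ t p) :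
    |wilsonAction4 W - wilsonAction4 (mulField E W) + ∑ p : Plaq P j, (1 - reTr (twistedCobd E W p)) -
        ∑ p : Plaq P j, nReTr (linCobd E W p * (((GaugeField.plaqHol W p : Matrix.specialUnitaryGroup n ℂ) : Matrix n n ℂ) - 1))| ≤
      ∑ p : Plaq P j, (6 * t p ^ 2 + 4 * t p ^ 3 + t p ^ 4) * dist1 (GaugeField.plaqHol W p) := by
  rw [wilsonAction4_sub_mulField_eq_split, sub_add_cancel, ← Finset.sum_sub_distrib]
  exact (Finset.abs_sum_le_sum_abs _ _).trans (Finset.sum_le_sum fun p _ => abs_pairing_sub_lin_le E W p (h₁ p) (h₂ p) (h₃ p) (h₄ p))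

/-- QUADRATIC COST in `SU(n)`: `0 ≤ Σ_p (1 − reTr H_p) ≤ 8·Σ_p t_p²`. [cite: Balaban1987RG1, (0.14) p.254] -/
theorem sum_one_sub_reTr_twistedCobd_le_SU (E W : GaugeField P j (Matrix.specialUnitaryGroup n ℂ)) {t : Plaq P j → ℝ}
    (h₁ : ∀ p : Plaq P j, dist1 (E ⟨p.src, p.μ⟩) ≤ t p) (h₂ : ∀ p : Plaq P j, dist1 (E ⟨p.src.shift p.μ, p.ν⟩) ≤ t p)
    (h₃ : ∀ p : Plaq P j, dist1 (E ⟨p.src.shift p.ν, p.μ⟩) ≤ t p) (h₄ : ∀ p : Plaq P j, dist1 (E ⟨p.src, p.ν⟩) ≤ t p) :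
    ∑ p : Plaq P j, (1 - reTr (twistedCobd E W p)) ≤ 8 * ∑ p : Plaq P j, t p ^ 2 := by
  have h := sum_one_sub_reTr_twistedCobd_le (G := Matrix.specialUnitaryGroup n ℂ) (cG := 1 / 2)
    one_sub_reTr_le_half_dist1_sq (by norm_num) W h₁ h₂ h₃ h₄
  refine h.trans (le_of_eq ?_)
  rw [Finset.mul_sum, Finset.mul_sum]
  exact Finset.sum_congr rfl fun p _ => by ring

/-- ★ **MAIN LETTER, LOWER HALF (the `hgap` shape)**: in `SU(n)`, for a left sweep `E` whose factors on `∂p` are within `t_p` of `1`,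
`Σ_p Λ_p − Σ_p (6t_p²+4t_p³+t_p⁴)·dist1 W(∂p) − 8·Σ_p t_p² ≤ A(W) − A(E·W)`:
undoing the sweep lowers the action by at least «linear statistic − second-order remainder − quadratic cost».
[cite: Balaban1987RG1, (0.2) p.252] -/
theorem lin_sub_le_wilsonAction4_sub_mulField (E W : GaugeField P j (Matrix.specialUnitaryGroup n ℂ)) {t : Plaq P j → ℝ}
    (h₁ : ∀ p : Plaq P j, dist1 (E ⟨p.src, p.μ⟩) ≤ t p) (h₂ : ∀ p : Plaq P j, dist1 (E ⟨p.src.shift p.μ, p.ν⟩) ≤ t p)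
    (h₃ : ∀ p : Plaq P j, dist1 (E ⟨p.src.shift p.ν, p.μ⟩) ≤ t p) (h₄ : ∀ p : Plaq P j, dist1 (E ⟨p.src, p.ν⟩) ≤ t p) :
    (∑ p : Plaq P j, nReTr (linCobd E W p * (((GaugeField.plaqHol W p : Matrix.specialUnitaryGroup n ℂ) : Matrix n n ℂ) - 1))) -
        (∑ p : Plaq P j, (6 * t p ^ 2 + 4 * t p ^ 3 + t p ^ 4) * dist1 (GaugeField.plaqHol W p)) -
        8 * ∑ p : Plaq P j, t p ^ 2 ≤
      wilsonAction4 W - wilsonAction4 (mulField E W) := by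
  have h := (abs_le.mp (abs_wilsonAction4_sub_mulField_add_quad_sub_lin_le E W h₁ h₂ h₃ h₄)).1
  have hq := sum_one_sub_reTr_twistedCobd_le_SU E W h₁ h₂ h₃ h₄
  linarith

/-- ★ **MAIN LETTER, UPPER HALF**: `A(W) − A(E·W) ≤ Σ_p Λ_p + Σ_p (6t_p²+4t_p³+t_p⁴)·dist1 W(∂p)` (the quadratic cost only helps).
[cite: Balaban1987RG1, (0.2) p.252] -/
theorem wilsonAction4_sub_mulField_le (E W : GaugeField P j (Matrix.specialUnitaryGroup n ℂ)) {t : Plaq P j → ℝ}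
    (h₁ : ∀ p : Plaq P j, dist1 (E ⟨p.src, p.μ⟩) ≤ t p) (h₂ : ∀ p : Plaq P j, dist1 (E ⟨p.src.shift p.μ, p.ν⟩) ≤ t p)
    (h₃ : ∀ p : Plaq P j, dist1 (E ⟨p.src.shift p.ν, p.μ⟩) ≤ t p) (h₄ : ∀ p : Plaq P j, dist1 (E ⟨p.src, p.ν⟩) ≤ t p) :
    wilsonAction4 W - wilsonAction4 (mulField E W) ≤
      (∑ p : Plaq P j, nReTr (linCobd E W p * (((GaugeField.plaqHol W p : Matrix.specialUnitaryGroup n ℂ) : Matrix n n ℂ) - 1))) +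
        ∑ p : Plaq P j, (6 * t p ^ 2 + 4 * t p ^ 3 + t p ^ 4) * dist1 (GaugeField.plaqHol W p) := by
  have h := (abs_le.mp (abs_wilsonAction4_sub_mulField_add_quad_sub_lin_le E W h₁ h₂ h₃ h₄)).2
  have hq := sum_one_sub_reTr_twistedCobd_nonneg E W
  linarith

/-- The `β`-scaled lower half, literally the premise shape `m ≤ β·(A(V) − A(Ψ′V))` of
✓ `CovariantDischargeSweepGapReduction.gibbsK_real_le_exp_neg_of_gap` with `Ψ′V = E·V`: any `m` below
`β·(Σ_p Λ_p − Σ_p (6t_p²+4t_p³+t_p⁴)·dist1 V(∂p) − 8·Σ_p t_p²)` is an action gap. [cite: Balaban1985UV3, (1)-(3) p.256] -/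
theorem le_mul_wilsonAction4_sub_mulField {β m : ℝ} (hβ : 0 ≤ β) (E V : GaugeField P j (Matrix.specialUnitaryGroup n ℂ))
    {t : Plaq P j → ℝ}
    (h₁ : ∀ p : Plaq P j, dist1 (E ⟨p.src, p.μ⟩) ≤ t p) (h₂ : ∀ p : Plaq P j, dist1 (E ⟨p.src.shift p.μ, p.ν⟩) ≤ t p)
    (h₃ : ∀ p : Plaq P j, dist1 (E ⟨p.src.shift p.ν, p.μ⟩) ≤ t p) (h₄ : ∀ p : Plaq P j, dist1 (E ⟨p.src, p.ν⟩) ≤ t p)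
    (hm : m ≤ β * ((∑ p : Plaq P j, nReTr (linCobd E V p *
        (((GaugeField.plaqHol V p : Matrix.specialUnitaryGroup n ℂ) : Matrix n n ℂ) - 1))) -
        (∑ p : Plaq P j, (6 * t p ^ 2 + 4 * t p ^ 3 + t p ^ 4) * dist1 (GaugeField.plaqHol V p)) -
        8 * ∑ p : Plaq P j, t p ^ 2)) :
    m ≤ β * (wilsonAction4 V - wilsonAction4 (mulField E V)) :=
  hm.trans (mul_le_mul_of_nonneg_left (lin_sub_le_wilsonAction4_sub_mulField E V h₁ h₂ h₃ h₄) hβ)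

end SU

end Summit.QuantumFields.YangMills.Theorems.CovariantDischargeSweepActionVariation

end
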